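import Literature.MeasureTheory.RestrictedProduct.QuotientMeasureNormalized
import Literature.NumberTheory.Automorphic.OrbitalMeasureOfLocal
import Literature.MeasureTheory.Group.InvariantQuotientTransport
import HarnessLib

/-!
# The orbital measure built from local QUOTIENT measures is the quotient measure of the restricted-product Haar measures
# (models layer of ★ `RestrictedProduct/QuotientMeasureNormalized` over ★ `orbitalMeasureOfLocal`; Weil constant ONE)
(Tate, in Cassels–Fröhlich (1967) Ch. XV §3.3; Rogawski (1990) §4.3 p. 44, §5.4 p. 72: `dg = ⊗_v dg_v`, `dt = ⊗_v dt_v`; Gelbart (1975) (10.19))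

Topic `NumberTheory/Automorphic`; THEOREMS ONLY (no definition, no instance, no named fact).

* §1 `RestrictedProduct.map_quotientHomeomorph_symm_rpMeasure_quotientMeasure_eq_quotientMeasure_of_forall_mem_iff` — the core
  identification ★ `map_quotientHomeomorph_symm_rpMeasure_quotientMeasure_eq_quotientMeasure` read on `(Πʳ G_i) ⧸ M` for ANY subgroup `M`
  with `x ∈ M ↔ ∀ i, x_i ∈ H_i` (e.g. the centraliser `C(γ)` of an adelic point, ★ `mem_centralizer_singleton_iff_forall_mem`), the torus
  measure being transported along the identity `cutout K H ≃ M` (★ `map_cosetCongr_quotientMeasure` at `e = 1`).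
* §2 **`orbitalMeasureOfLocal_eq_map_quotientMeasure`** — in the setting of ★ `orbitalMeasureOfLocal K ψ e γ γloc hγloc m S₀` (model
  `e : G_f ≃ₜ* Πʳ G_i`, local models `ψ_i : G_i ≃ₜ* L_i`, local orbital measures `m_i` on `L_i ⧸ C(γloc i)`): if, read back on `G_i ⧸ C((eγ)_i)`
  along `ψ_i⁻¹`, the `m_i` ARE local quotient measures `ν_i ∕ t_i` (`quotientMeasure (C (eγ)_i) (t_i) (ν_i)`; hypothesis `hm`, which a consumer
  obtains from ★ `map_cosetCongr_quotientMeasure`) normalised off `S₀`, then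
  `orbitalMeasureOfLocal … m S₀ = (quotientMeasure C(eγ) t_M ν′).map (cosetCongr e⁻¹)` with `ν′ = ∏'(ν_i ; K_i)` and `t_M` the restricted-product
  torus measure on `C(eγ) = ∏' C((eγ)_i)`; and **`orbitalMeasureOfLocal_eq_quotientMeasure`** — `= quotientMeasure C(γ) t_f ν_f` for the
  transports `ν_f = e⁻¹_* ν′`, `t_f = (e⁻¹|_{C(eγ)})_* t_M` to `G_f` (★ `map_cosetCongr_quotientMeasure`).

(The `∞ × f` step — `orbitalMeasureOfProd` of two quotient measures — is the sibling file `Group/OrbitalMeasureOfProdQuotient`.)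

WHY.  Junction (O10-b3) of the F0/P3a line: the kit's `ofLocal` adelic orbital measures built from CANONICAL local families `dg_v ∕ dt_v` are THE
quotient measures `dg ∕ dt` for the restricted-product Haar measures, so that their orbital weights are the covolumes `m(T(F) \ T(𝔸))` of
★ `UnitaryGroupDiagTraceNormalized` ∕ `AdelicGroupDataGeometricSideCovol`, transported across stable classes by ★ `LatticeCovolumeTransport`.

## References
* J. W. S. Cassels, A. Fröhlich (eds.), *Algebraic Number Theory* (1967), Ch. XV (Tate) §3.3 [CasselsFrohlichANT1967].
* J. D. Rogawski, *Automorphic Representations of Unitary Groups in Three Variables* (1990), §4.3 p. 44, §5.4 p. 72 [Rogawski1990].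
* S. Gelbart, *Automorphic forms on adele groups* (1975), p. 155 (10.19) [Gelbart1975].
-/

set_option autoImplicit false

noncomputable section

open _root_.MeasureTheory _root_.MeasureTheory.Measure Set Filter Function
open _root_.Topology
open Literature.Topology.RestrictedProduct Literature.Topology.Algebra.RestrictedProduct Literature.MeasureTheory.Group
open scoped RestrictedProduct ENNReal NNReal Pointwise

/-! ## §1 The core identification on `(Πʳ G_i) ⧸ M` for any fibrewise-defined `M` -/

namespace Literature.MeasureTheory.RestrictedProduct

universe u v

section AnyM

variable {ι : Type u} [Countable ι] {G : ι → Type v} [∀ i, Group (G i)] [∀ i, TopologicalSpace (G i)]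
  [∀ i, IsTopologicalGroup (G i)] [∀ i, LocallyCompactSpace (G i)] [∀ i, SecondCountableTopology (G i)] [∀ i, T2Space (G i)]
  [∀ i, MeasurableSpace (G i)] [∀ i, BorelSpace (G i)]
  (K : ∀ i, Subgroup (G i)) (H : ∀ i, Subgroup (G i)) [hKo : Fact (∀ i, IsOpen (K i : Set (G i)))]
  [hKc : ∀ i, CompactSpace (K i)] [hH : ∀ i, IsClosed ((H i : Subgroup (G i)) : Set (G i))]
  [BorelSpace (Πʳ i, [G i, K i])] [SecondCountableTopology (Πʳ i, [G i, K i])]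
  [∀ i, MeasurableSpace (G i ⧸ H i)] [∀ i, BorelSpace (G i ⧸ H i)] [∀ i, SecondCountableTopology (G i ⧸ H i)]
  [MeasurableSpace ((Πʳ i, [G i, K i]) ⧸ (cutout K H : Subgroup (Πʳ i, [G i, K i])))]
  [BorelSpace ((Πʳ i, [G i, K i]) ⧸ (cutout K H : Subgroup (Πʳ i, [G i, K i])))]
  (M : Subgroup (Πʳ i, [G i, K i])) (hM : ∀ x : Πʳ i, [G i, K i], x ∈ M ↔ ∀ i, x i ∈ H i)
  [MeasurableSpace ((Πʳ i, [G i, K i]) ⧸ M)] [BorelSpace ((Πʳ i, [G i, K i]) ⧸ M)]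
  (ν : ∀ i, Measure (G i)) [∀ i, IsHaarMeasure (ν i)] [∀ i, (ν i).IsMulRightInvariant]
  (t : ∀ i, Measure (H i)) [∀ i, (t i).IsMulLeftInvariant] [∀ i, IsFiniteMeasureOnCompacts (t i)]
  [∀ i, (t i).IsOpenPosMeasure] [∀ i, (t i).IsInvInvariant] [∀ i, SFinite (t i)] [∀ i, SigmaFinite (t i)]
  (S₀ : Finset ι)
  (ν' : Measure (Πʳ i, [G i, K i])) [IsHaarMeasure ν'] [ν'.IsMulRightInvariant]
  (ρ : Measure (cutout K H : Subgroup (Πʳ i, [G i, K i]))) [ρ.IsMulLeftInvariant] [IsFiniteMeasureOnCompacts ρ]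
  [ρ.IsOpenPosMeasure] [ρ.IsInvInvariant] [SFinite ρ]
  (ρM : Measure M) [ρM.IsMulLeftInvariant] [IsFiniteMeasureOnCompacts ρM] [ρM.IsOpenPosMeasure] [ρM.IsInvInvariant] [SFinite ρM]

omit [Countable ι] [∀ i, IsTopologicalGroup (G i)] [∀ i, LocallyCompactSpace (G i)] [∀ i, SecondCountableTopology (G i)]
  [∀ i, T2Space (G i)] [∀ i, MeasurableSpace (G i)] [∀ i, BorelSpace (G i)] hKo hKc [BorelSpace (Πʳ i, [G i, K i])]
  [SecondCountableTopology (Πʳ i, [G i, K i])] [∀ i, MeasurableSpace (G i ⧸ H i)] [∀ i, BorelSpace (G i ⧸ H i)]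
  [∀ i, SecondCountableTopology (G i ⧸ H i)]
  [MeasurableSpace ((Πʳ i, [G i, K i]) ⧸ (cutout K H : Subgroup (Πʳ i, [G i, K i])))]
  [BorelSpace ((Πʳ i, [G i, K i]) ⧸ (cutout K H : Subgroup (Πʳ i, [G i, K i])))]
  [MeasurableSpace ((Πʳ i, [G i, K i]) ⧸ M)] [BorelSpace ((Πʳ i, [G i, K i]) ⧸ M)] in
include hM in
/-- A fibrewise-defined subgroup `M` (`x ∈ M ↔ ∀ i, x_i ∈ H_i`) IS `cutout K H` as a set, hence closed when the `H_i` are.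
[cite: CasselsFrohlichANT1967, Ch. XV (Tate) §3.3] -/
theorem isClosed_of_forall_mem_iff : IsClosed ((M : Subgroup (Πʳ i, [G i, K i])) : Set (Πʳ i, [G i, K i])) := by
  have h : ((M : Subgroup (Πʳ i, [G i, K i])) : Set (Πʳ i, [G i, K i])) = (cutout K H : Subgroup (Πʳ i, [G i, K i])) := by
    ext x
    rw [SetLike.mem_coe, SetLike.mem_coe, hM x, mem_cutout_iff]
  rw [h]
  exact isClosed_cutout K H hH

omit [Countable ι] [∀ i, TopologicalSpace (G i)] [∀ i, IsTopologicalGroup (G i)] [∀ i, LocallyCompactSpace (G i)]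
  [∀ i, SecondCountableTopology (G i)] [∀ i, T2Space (G i)] [∀ i, MeasurableSpace (G i)] [∀ i, BorelSpace (G i)] hKo hKc hH
  [BorelSpace (Πʳ i, [G i, K i])] [SecondCountableTopology (Πʳ i, [G i, K i])] [∀ i, MeasurableSpace (G i ⧸ H i)]
  [∀ i, BorelSpace (G i ⧸ H i)] [∀ i, SecondCountableTopology (G i ⧸ H i)]
  [MeasurableSpace ((Πʳ i, [G i, K i]) ⧸ (cutout K H : Subgroup (Πʳ i, [G i, K i])))]
  [BorelSpace ((Πʳ i, [G i, K i]) ⧸ (cutout K H : Subgroup (Πʳ i, [G i, K i])))]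
  [MeasurableSpace ((Πʳ i, [G i, K i]) ⧸ M)] [BorelSpace ((Πʳ i, [G i, K i]) ⧸ M)] in
include hM in
/-- The identity of `Πʳ G_i` carries `cutout K H` onto `M`. [cite: CasselsFrohlichANT1967, Ch. XV (Tate) §3.3] -/
theorem forall_refl_mem_iff : ∀ g : Πʳ i, [G i, K i], (MulEquiv.refl (Πʳ i, [G i, K i])) g ∈ M ↔ g ∈ cutout K H :=
  fun g => (hM g).trans (mem_cutout_iff K H).symm

/-- **The core identification, read on `(Πʳ G_i) ⧸ M` for any fibrewise-defined `M`** (`x ∈ M ↔ ∀ i, x_i ∈ H_i`): with the torus measure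
`t_M` on `M` obtained from `(∏'(t_i ; H_i ∩ K_i)).map cutoutEquiv` along the identity `cutout K H ≃ M`,
`(∏'(ν_i ∕ t_i ; π K_i)).map (quotientHomeomorph K H M)⁻¹ = quotientMeasure M t_M ν′`. [cite: CasselsFrohlichANT1967, Ch. XV (Tate) §3.3] -/
theorem map_quotientHomeomorph_symm_rpMeasure_quotientMeasure_eq_quotientMeasure_of_forall_mem_iff
    (hν1 : ∀ i, i ∉ S₀ → ν i (K i : Set (G i)) = 1)
    (ht1 : ∀ i, i ∉ S₀ → t i ((inH K H i : Subgroup (H i)) : Set (H i)) = 1)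
    (hm1 : ∀ i, i ∉ S₀ → quotientMeasure (H i) (t i) (hH i) (ν i) (quotBase K H i) = 1)
    (hν' : ν' = rpMeasure (fun i => (K i : Set (G i))) ν S₀)
    (hρ : ρ = Measure.map (cutoutEquiv K H) (rpMeasure (fun i => ((inH K H i : Subgroup (H i)) : Set (H i))) t S₀))
    (hρM : ρM = Measure.map (subgroupCongrHomeomorph (MulEquiv.refl (Πʳ i, [G i, K i])) (cutout K H) M
      (forall_refl_mem_iff K H M hM) continuous_id continuous_id) ρ) :
    (rpMeasure (fun i => quotBase K H i) (fun i => quotientMeasure (H i) (t i) (hH i) (ν i)) S₀).map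
        (quotientHomeomorph K H M hM hKo.out).symm =
      quotientMeasure M ρM (isClosed_of_forall_mem_iff K H M hM) ν' := by
  haveI hMc : IsClosed ((M : Subgroup (Πʳ i, [G i, K i])) : Set (Πʳ i, [G i, K i])) := isClosed_of_forall_mem_iff K H M hM
  haveI hCc : IsClosed ((cutout K H : Subgroup (Πʳ i, [G i, K i])) : Set (Πʳ i, [G i, K i])) := isClosed_cutout K H hH
  have hcore := map_quotientHomeomorph_symm_rpMeasure_quotientMeasure_eq_quotientMeasure K H ν t S₀ ν' ρ hν1 ht1 hm1 hν' hρ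
  -- `quotientHomeomorph⁻¹` for `M` is `cosetCongr 1` after `quotientHomeomorph⁻¹` for `cutout K H`
  have hfun : ⇑(quotientHomeomorph K H M hM hKo.out).symm =
      cosetCongr (MulEquiv.refl (Πʳ i, [G i, K i])) (cutout K H) M (forall_refl_mem_iff K H M hM) ∘
        ⇑(quotientHomeomorph K H (cutout K H) (mem_cutout_iff' K H) hKo.out).symm := by
    funext z
    obtain ⟨x, hx⟩ : ∃ x : Πʳ i, [G i, K i], quotientMap K H x = z := by
      obtain ⟨p, hp⟩ := (quotientHomeomorph K H (cutout K H) (mem_cutout_iff' K H) hKo.out).surjective z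
      obtain ⟨x, rfl⟩ := QuotientGroup.mk_surjective p
      exact ⟨x, by rw [← hp, quotientHomeomorph_mk]⟩
    subst hx
    rw [Function.comp_apply, quotientHomeomorph_symm_quotientMap, quotientHomeomorph_symm_quotientMap, cosetCongr_mk]
    rfl
  have hmeas : Measurable (cosetCongr (MulEquiv.refl (Πʳ i, [G i, K i])) (cutout K H) M (forall_refl_mem_iff K H M hM)) :=
    (continuous_cosetCongr _ (cutout K H) M (forall_refl_mem_iff K H M hM) continuous_id).measurable
  rw [hfun, ← Measure.map_map hmeas (measurable_quotientHomeomorph_symm K H (cutout K H) (mem_cutout_iff' K H)), hcore]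
  exact map_cosetCongr_quotientMeasure (MulEquiv.refl (Πʳ i, [G i, K i])) continuous_id continuous_id (cutout K H) M
    (forall_refl_mem_iff K H M hM) ρ ρM ν' ν' hρM (by rw [MulEquiv.coe_refl, Measure.map_id])

end AnyM

end Literature.MeasureTheory.RestrictedProduct

/-! ## §2 The models layer over `orbitalMeasureOfLocal` -/

namespace Literature.NumberTheory.Automorphic

open Literature.MeasureTheory.RestrictedProduct

section Models

variable {ι : Type} [Countable ι] {G : ι → Type} [∀ i, Group (G i)] [∀ i, TopologicalSpace (G i)]
  [∀ i, IsTopologicalGroup (G i)] [∀ i, SecondCountableTopology (G i)] [∀ i, LocallyCompactSpace (G i)] [∀ i, T2Space (G i)]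
  [∀ i, MeasurableSpace (G i)] [∀ i, BorelSpace (G i)]
  (K : ∀ i, Subgroup (G i)) [hKo : Fact (∀ i, IsOpen (K i : Set (G i)))] [hKc : ∀ i, CompactSpace (K i)]
  [BorelSpace (Πʳ i, [G i, K i])] [SecondCountableTopology (Πʳ i, [G i, K i])]
  {Lc : ι → Type} [∀ i, Group (Lc i)] [∀ i, TopologicalSpace (Lc i)] (ψ : ∀ i, G i ≃ₜ* Lc i)
  {Gf : Type} [Group Gf] [TopologicalSpace Gf] [IsTopologicalGroup Gf]
  (e : Gf ≃ₜ* (Πʳ i, [G i, K i])) (γ : Gf) (γloc : ∀ i, Lc i) (hγloc : ∀ i, ψ i (e γ i) = γloc i)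
  [MeasurableSpace (Gf ⧸ Subgroup.centralizer ({γ} : Set Gf))] [BorelSpace (Gf ⧸ Subgroup.centralizer ({γ} : Set Gf))]
  [∀ i, MeasurableSpace (Lc i ⧸ Subgroup.centralizer ({γloc i} : Set (Lc i)))]
  [∀ i, BorelSpace (Lc i ⧸ Subgroup.centralizer ({γloc i} : Set (Lc i)))]
  (m : ∀ i, Measure (Lc i ⧸ Subgroup.centralizer ({γloc i} : Set (Lc i))))
  -- Borel structures on the model orbit spaces (any: they are the Borel ones)
  [iMS : ∀ i, MeasurableSpace (G i ⧸ Subgroup.centralizer ({e γ i} : Set (G i)))]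
  [iBS : ∀ i, BorelSpace (G i ⧸ Subgroup.centralizer ({e γ i} : Set (G i)))]
  [jMS : MeasurableSpace ((Πʳ i, [G i, K i]) ⧸ Subgroup.centralizer ({e γ} : Set (Πʳ i, [G i, K i])))]
  [jBS : BorelSpace ((Πʳ i, [G i, K i]) ⧸ Subgroup.centralizer ({e γ} : Set (Πʳ i, [G i, K i])))]
  [MeasurableSpace ((Πʳ i, [G i, K i]) ⧸ (cutout K (fun i => Subgroup.centralizer ({e γ i} : Set (G i))) : Subgroup (Πʳ i, [G i, K i])))]
  [BorelSpace ((Πʳ i, [G i, K i]) ⧸ (cutout K (fun i => Subgroup.centralizer ({e γ i} : Set (G i))) : Subgroup (Πʳ i, [G i, K i])))]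
  [hC : ∀ i, IsClosed ((Subgroup.centralizer ({e γ i} : Set (G i)) : Subgroup (G i)) : Set (G i))]
  -- the Haar data on the model side
  (ν' : ∀ i, Measure (G i)) [∀ i, IsHaarMeasure (ν' i)] [∀ i, (ν' i).IsMulRightInvariant]
  (t' : ∀ i, Measure (Subgroup.centralizer ({e γ i} : Set (G i)))) [∀ i, (t' i).IsMulLeftInvariant]
  [∀ i, IsFiniteMeasureOnCompacts (t' i)] [∀ i, (t' i).IsOpenPosMeasure] [∀ i, (t' i).IsInvInvariant] [∀ i, SFinite (t' i)]
  [∀ i, SigmaFinite (t' i)]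
  (S₀ : Finset ι)
  (νrp : Measure (Πʳ i, [G i, K i])) [IsHaarMeasure νrp] [νrp.IsMulRightInvariant]
  (ρ : Measure (cutout K (fun i => Subgroup.centralizer ({e γ i} : Set (G i))) : Subgroup (Πʳ i, [G i, K i])))
  [ρ.IsMulLeftInvariant] [IsFiniteMeasureOnCompacts ρ] [ρ.IsOpenPosMeasure] [ρ.IsInvInvariant] [SFinite ρ]
  (ρM : Measure (Subgroup.centralizer ({e γ} : Set (Πʳ i, [G i, K i]))))
  [ρM.IsMulLeftInvariant] [IsFiniteMeasureOnCompacts ρM] [ρM.IsOpenPosMeasure] [ρM.IsInvInvariant] [SFinite ρM]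

omit [IsTopologicalGroup Gf] [BorelSpace (Gf ⧸ Subgroup.centralizer ({γ} : Set Gf))]
  [∀ i, BorelSpace (Lc i ⧸ Subgroup.centralizer ({γloc i} : Set (Lc i)))] in
/-- **`orbitalMeasureOfLocal` of local QUOTIENT measures is the transported adelic quotient measure** (Weil constant one): if the local
orbital measures `m_i`, read on `G_i ⧸ C((eγ)_i)` along `ψ_i⁻¹`, are `ν_i ∕ t_i = quotientMeasure C((eγ)_i) t_i ν_i` (hypothesis `hm`), with
`ν_i(K_i) = 1`, `t_i(C ∩ K_i) = 1`, `(ν_i∕t_i)(π K_i) = 1` off `S₀`, then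
`orbitalMeasureOfLocal K ψ e γ γloc hγloc m S₀ = (quotientMeasure C(eγ) t_M ν′).map (cosetCongr e⁻¹)` for `ν′ = ∏'(ν_i ; K_i)` and the
restricted-product torus measure `t_M` on `C(eγ) = ∏' C((eγ)_i)` (hypotheses `hν'`, `hρ`, `hρM`). [cite: CasselsFrohlichANT1967, Ch. XV (Tate) §3.3] -/
theorem orbitalMeasureOfLocal_eq_map_quotientMeasure
    (hm : ∀ i, Measure.map (cosetCongr (ψ i).symm.toMulEquiv _ (Subgroup.centralizer ({e γ i} : Set (G i)))
        (forall_apply_mem_centralizer_singleton_iff_of_eq _ (orbitalModelPoint_eq K ψ e γ γloc hγloc i))) (m i) =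
      quotientMeasure (Subgroup.centralizer ({e γ i} : Set (G i))) (t' i) (hC i) (ν' i))
    (hν1 : ∀ i, i ∉ S₀ → ν' i (K i : Set (G i)) = 1)
    (ht1 : ∀ i, i ∉ S₀ → t' i ((inH K (fun i => Subgroup.centralizer ({e γ i} : Set (G i))) i :
      Subgroup (Subgroup.centralizer ({e γ i} : Set (G i)))) : Set (Subgroup.centralizer ({e γ i} : Set (G i)))) = 1)
    (hm1 : ∀ i, i ∉ S₀ → quotientMeasure (Subgroup.centralizer ({e γ i} : Set (G i))) (t' i) (hC i) (ν' i)
      (quotBase K (fun i => Subgroup.centralizer ({e γ i} : Set (G i))) i) = 1)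
    (hν' : νrp = rpMeasure (fun i => (K i : Set (G i))) ν' S₀)
    (hρ : ρ = Measure.map (cutoutEquiv K (fun i => Subgroup.centralizer ({e γ i} : Set (G i))))
      (rpMeasure (fun i => ((inH K (fun i => Subgroup.centralizer ({e γ i} : Set (G i))) i :
        Subgroup (Subgroup.centralizer ({e γ i} : Set (G i)))) : Set (Subgroup.centralizer ({e γ i} : Set (G i))))) t' S₀))
    (hρM : ρM = Measure.map (subgroupCongrHomeomorph (MulEquiv.refl (Πʳ i, [G i, K i]))
      (cutout K (fun i => Subgroup.centralizer ({e γ i} : Set (G i)))) (Subgroup.centralizer ({e γ} : Set (Πʳ i, [G i, K i])))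
      (forall_refl_mem_iff K (fun i => Subgroup.centralizer ({e γ i} : Set (G i))) _ (mem_centralizer_singleton_iff_forall_mem K (e γ)))
      continuous_id continuous_id) ρ) :
    orbitalMeasureOfLocal K ψ e γ γloc hγloc m S₀ =
      (quotientMeasure (Subgroup.centralizer ({e γ} : Set (Πʳ i, [G i, K i]))) ρM
          (isClosed_of_forall_mem_iff K (fun i => Subgroup.centralizer ({e γ i} : Set (G i))) _
            (mem_centralizer_singleton_iff_forall_mem K (e γ))) νrp).map
        (cosetCongr e.symm.toMulEquiv _ (Subgroup.centralizer ({γ} : Set Gf))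
          (forall_apply_mem_centralizer_singleton_iff_of_eq e.symm.toMulEquiv (e.symm_apply_apply γ))) := by
  -- the Borel structures are the ones fixed inside the definition
  obtain rfl : iMS = fun i => borel _ := funext fun i => (iBS i).measurable_eq
  obtain rfl : jMS = borel _ := jBS.measurable_eq
  letI : ∀ i, MeasurableSpace (G i ⧸ Subgroup.centralizer ({e γ i} : Set (G i))) := fun _ => borel _
  haveI : ∀ i, BorelSpace (G i ⧸ Subgroup.centralizer ({e γ i} : Set (G i))) := fun _ => ⟨rfl⟩
  letI : MeasurableSpace ((Πʳ i, [G i, K i]) ⧸ Subgroup.centralizer ({e γ} : Set (Πʳ i, [G i, K i]))) := borel _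
  haveI : BorelSpace ((Πʳ i, [G i, K i]) ⧸ Subgroup.centralizer ({e γ} : Set (Πʳ i, [G i, K i]))) := ⟨rfl⟩
  -- unfold the definition (`rfl`, as in ★ `orbitalMeasureOfLocal_spec`)
  have hdef : orbitalMeasureOfLocal K ψ e γ γloc hγloc m S₀ =
      ((rpMeasure (fun i => quotBase K (fun i => Subgroup.centralizer ({e γ i} : Set (G i))) i)
        (fun i => (m i).map (cosetCongr (ψ i).symm.toMulEquiv _ (Subgroup.centralizer ({e γ i} : Set (G i)))
          (forall_apply_mem_centralizer_singleton_iff_of_eq _ (orbitalModelPoint_eq K ψ e γ γloc hγloc i)))) S₀).map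
        (quotientHomeomorph K (fun i => Subgroup.centralizer ({e γ i} : Set (G i)))
          (Subgroup.centralizer ({e γ} : Set (Πʳ i, [G i, K i]))) (mem_centralizer_singleton_iff_forall_mem K (e γ))
          hKo.out).symm).map
        (cosetCongr e.symm.toMulEquiv _ (Subgroup.centralizer ({γ} : Set Gf))
          (forall_apply_mem_centralizer_singleton_iff_of_eq e.symm.toMulEquiv (e.symm_apply_apply γ))) := rfl
  have hfam : (fun i => (m i).map (cosetCongr (ψ i).symm.toMulEquiv _ (Subgroup.centralizer ({e γ i} : Set (G i)))
      (forall_apply_mem_centralizer_singleton_iff_of_eq _ (orbitalModelPoint_eq K ψ e γ γloc hγloc i)))) =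
      fun i => quotientMeasure (Subgroup.centralizer ({e γ i} : Set (G i))) (t' i) (hC i) (ν' i) := funext hm
  rw [hdef, hfam,
    map_quotientHomeomorph_symm_rpMeasure_quotientMeasure_eq_quotientMeasure_of_forall_mem_iff K
      (fun i => Subgroup.centralizer ({e γ i} : Set (G i))) _ (mem_centralizer_singleton_iff_forall_mem K (e γ))
      ν' t' S₀ νrp ρ ρM hν1 ht1 hm1 hν' hρ hρM]

variable [LocallyCompactSpace Gf] [SecondCountableTopology Gf] [T2Space Gf] [MeasurableSpace Gf] [BorelSpace Gf]
  (νf : Measure Gf) [IsHaarMeasure νf] [νf.IsMulRightInvariant]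
  (tf : Measure (Subgroup.centralizer ({γ} : Set Gf))) [tf.IsMulLeftInvariant] [IsFiniteMeasureOnCompacts tf]
  [tf.IsOpenPosMeasure] [tf.IsInvInvariant] [SFinite tf]

omit [∀ i, BorelSpace (Lc i ⧸ Subgroup.centralizer ({γloc i} : Set (Lc i)))] in
/-- **`orbitalMeasureOfLocal` of local quotient measures IS the quotient measure `ν_f ∕ t_f` on `G_f ⧸ C(γ)`** for the transports
`ν_f = e⁻¹_* ∏'(ν_i ; K_i)` and `t_f = (e⁻¹|_{C(eγ)})_* t_M` of the restricted-product Haar measures (Weil constant one):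
`orbitalMeasureOfLocal K ψ e γ γloc hγloc m S₀ = quotientMeasure C(γ) t_f ν_f`. [cite: Rogawski1990, §5.4 p. 72] -/
theorem orbitalMeasureOfLocal_eq_quotientMeasure
    (hCγ : IsClosed ((Subgroup.centralizer ({γ} : Set Gf) : Subgroup Gf) : Set Gf))
    (hm : ∀ i, Measure.map (cosetCongr (ψ i).symm.toMulEquiv _ (Subgroup.centralizer ({e γ i} : Set (G i)))
        (forall_apply_mem_centralizer_singleton_iff_of_eq _ (orbitalModelPoint_eq K ψ e γ γloc hγloc i))) (m i) =
      quotientMeasure (Subgroup.centralizer ({e γ i} : Set (G i))) (t' i) (hC i) (ν' i))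
    (hν1 : ∀ i, i ∉ S₀ → ν' i (K i : Set (G i)) = 1)
    (ht1 : ∀ i, i ∉ S₀ → t' i ((inH K (fun i => Subgroup.centralizer ({e γ i} : Set (G i))) i :
      Subgroup (Subgroup.centralizer ({e γ i} : Set (G i)))) : Set (Subgroup.centralizer ({e γ i} : Set (G i)))) = 1)
    (hm1 : ∀ i, i ∉ S₀ → quotientMeasure (Subgroup.centralizer ({e γ i} : Set (G i))) (t' i) (hC i) (ν' i)
      (quotBase K (fun i => Subgroup.centralizer ({e γ i} : Set (G i))) i) = 1)
    (hν' : νrp = rpMeasure (fun i => (K i : Set (G i))) ν' S₀)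
    (hρ : ρ = Measure.map (cutoutEquiv K (fun i => Subgroup.centralizer ({e γ i} : Set (G i))))
      (rpMeasure (fun i => ((inH K (fun i => Subgroup.centralizer ({e γ i} : Set (G i))) i :
        Subgroup (Subgroup.centralizer ({e γ i} : Set (G i)))) : Set (Subgroup.centralizer ({e γ i} : Set (G i))))) t' S₀))
    (hρM : ρM = Measure.map (subgroupCongrHomeomorph (MulEquiv.refl (Πʳ i, [G i, K i]))
      (cutout K (fun i => Subgroup.centralizer ({e γ i} : Set (G i)))) (Subgroup.centralizer ({e γ} : Set (Πʳ i, [G i, K i])))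
      (forall_refl_mem_iff K (fun i => Subgroup.centralizer ({e γ i} : Set (G i))) _ (mem_centralizer_singleton_iff_forall_mem K (e γ)))
      continuous_id continuous_id) ρ)
    (hνf : νf = Measure.map e.symm.toMulEquiv νrp)
    (htf : tf = Measure.map (subgroupCongrHomeomorph e.symm.toMulEquiv (Subgroup.centralizer ({e γ} : Set (Πʳ i, [G i, K i])))
      (Subgroup.centralizer ({γ} : Set Gf)) (forall_apply_mem_centralizer_singleton_iff_of_eq e.symm.toMulEquiv (e.symm_apply_apply γ))
      e.symm.continuous e.continuous) ρM) :
    orbitalMeasureOfLocal K ψ e γ γloc hγloc m S₀ = quotientMeasure (Subgroup.centralizer ({γ} : Set Gf)) tf hCγ νf := by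
  haveI hMc : IsClosed ((Subgroup.centralizer ({e γ} : Set (Πʳ i, [G i, K i])) : Subgroup (Πʳ i, [G i, K i])) : Set (Πʳ i, [G i, K i])) :=
    isClosed_of_forall_mem_iff K (fun i => Subgroup.centralizer ({e γ i} : Set (G i))) _ (mem_centralizer_singleton_iff_forall_mem K (e γ))
  haveI := hCγ
  rw [orbitalMeasureOfLocal_eq_map_quotientMeasure K ψ e γ γloc hγloc m ν' t' S₀ νrp ρ ρM hm hν1 ht1 hm1 hν' hρ hρM]
  exact map_cosetCongr_quotientMeasure e.symm.toMulEquiv e.symm.continuous e.continuous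
    (Subgroup.centralizer ({e γ} : Set (Πʳ i, [G i, K i]))) (Subgroup.centralizer ({γ} : Set Gf))
    (forall_apply_mem_centralizer_singleton_iff_of_eq e.symm.toMulEquiv (e.symm_apply_apply γ)) ρM tf νrp νf htf hνf

end Models

end Literature.NumberTheory.Automorphic
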